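import Summits.HodgeConjecture.CorCM.GaloisBalancedWeightDegenerate
import Summits.HodgeConjecture.CorCM.GaloisRightTranslateRank
import Mathlib.GroupTheory.SpecificGroups.Dihedral
import Mathlib.GroupTheory.SpecificGroups.Quaternion
import HarnessLib

/-!
# Galois CM fields of degree `24` without imaginary quadratic subfield and non-dicyclic Galois group: simple
# DEGENERATE CM abelian 12-folds (kernel certificates: a primitive type balanced over a finite set moved by `c`)

COR-CM (cell `pub-hodgecm2`), binder seat b04 (gen 20), count-neutral claim DICYCLIC-TWO-SHEET, part VII — the
negative side of degree `24`.  By part IV (`CorCM/GaloisDicyclicNondegenerate`) and gen 12 (`ℤ/24`), the Galois groups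
`Dic₆` and `C₂₄` make every simple CM 12-fold nondegenerate; by gen 19's capstone every group of order `24` with an
index-`2` subgroup avoiding `c` (`A₄ × C₂`, `C₂² × S₃`, `Dic₃ × C₂` with `c ∉ Dic₃ × 1`, …) carries simple degenerate
12-folds (`[K:k] = 12` is not in the good list); gen 18 settles the abelian groups.  Here the remaining non-abelian
groups of order `24` with a CENTRAL involution, NO index-`2` subgroup avoiding it, and a Mathlib model — `D₁₂`
(`c = r⁶`), `Q₈ × C₃`, `Dic₃ × C₂` (all three central involutions), `C₃ × D₄` (`c = r²`), `C₄ × S₃ = C₄ × D₃`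
(`c = (2, 1)`) — are shown to carry PRIMITIVE DEGENERATE CM types, by kernel-decided certificates: a CM set `T₀` with
trivial left stabiliser (primitive, Shimura §8.2 Prop. 26) and a finite set `D` with `2·#{x ∈ D : x g ∈ T₀} = #D` for all
`g` and `c D ≠ D` (degenerate: a balanced weight that is not conjugation-invariant, gen 19
`not_isNondegenerate_of_galois_balanced`).  KERNEL ONLY: theorems; no definition, no named fact, no `sorry`.  `HC_CM` is
neither used nor claimed.  (`SL(2,3)` and `C₃ ⋊ C₈` — seat census: also degenerate — have no convenient Mathlib model and
are not treated.)

* §1 `exists_isPrimitive_not_isNondegenerate_of_model_balanced`, `exists_simple_degenerate_of_model_balanced` — the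
  certificate format on a group model `e : Gal(K/ℚ) ≃* G₀` (gen 17 `GaloisTable.exists_isPrimitive_of_tableModel` +
  gen 19 `not_isNondegenerate_of_galois_balanced`, pulled back along `e`).
* §2 the five models (seven central involutions); each `exists_simple_degenerate_of_mulEquiv_*`: a PRIMITIVE DEGENERATE
  CM type, realised by a SIMPLE abelian 12-fold with an exceptional Hodge class on some power (Shimura's existence
  theorem; Hazama's converse).

Seat census (`scratch-g20/census2.py`, exhaustive over the `2¹²` CM sets): primitive ∕ degenerate counts `D₁₂` 3360 ∕ 1152,
`Q₈ × C₃` 4080 ∕ 384, `Dic₃ × C₂` (`c = (a³, 0)`) 3960 ∕ 720, `C₃ × D₄` 3840 ∕ 1632, `C₄ × S₃` 3720 ∕ 576; `Dic₆` 4080 ∕ 0.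

## References

* [Shimura1998] G. Shimura, *Abelian Varieties with Complex Multiplication and Modular Functions*, §6.2 Thm. 3,
  §8.2 Prop. 26.
* [Gordon1999HodgeAVSurvey] B. B. Gordon, *A survey of the Hodge conjecture for abelian varieties*, Thm. 6.4, §9.3–9.4.
* [Dodson1984] B. Dodson, *The structure of Galois groups of CM-fields*, Trans. AMS 283 (1984), §3.1.1, §5.3.
-/

noncomputable section

open CategoryTheory CategoryTheory.Limits NumberField
open scoped BigOperators

namespace Summit.HodgeConjecture.CorCM.GaloisModels

open Literature.NumberTheory.ComplexMultiplication
open Literature.AlgebraicGeometry.Motives (AbelianVariety CMType)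
open Literature.AlgebraicGeometry.HodgeTheory
open Literature.AlgebraicGeometry.ComplexMultiplication (IsCMTypeRealisation isSimple_iff_isPrimitive)
open Literature.AlgebraicGeometry.Pohlmann1968
open Literature.Barriers.HodgeConjecture (divisorClassesSpan)
open Summit.HodgeConjecture.CorCM.GaloisRank
open Summit.HodgeConjecture.CorCM.TwiceOdd (not_isNondegenerate_of_galois_balanced)
open Summit.HodgeConjecture.CorCM.AbelianSixteen (exists_simple_realisation_of_isPrimitive)

variable {K : Type} [Field K] [NumberField K] [IsCMField K]

/-! ## §1 The certificate format: primitive set + balanced finite set on a group model -/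

/-- **Model certificate ⟹ primitive degenerate CM type.**  `e : Gal(K/ℚ) ≃* G₀`, `c₀ = e(c)`; a CM set `T₀ ⊆ G₀`
(`x ∈ T₀ ↔ c₀ x ∉ T₀`) with trivial left stabiliser, and a finite `D ⊆ G₀` with `2·#{x ∈ D : x g ∈ T₀} = #D` for all `g`
and `c₀ x ∉ D` for some `x ∈ D`.  Then `K` has a PRIMITIVE DEGENERATE CM type. [cite: Shimura1998, §8.2 Prop. 26]
[cite: Gordon1999HodgeAVSurvey, §9.3] -/
theorem exists_isPrimitive_not_isNondegenerate_of_model_balanced [IsGalois ℚ K] {G₀ : Type*} [Group G₀]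
    [Fintype G₀] [DecidableEq G₀] (e : (K ≃ₐ[ℚ] K) ≃* G₀) (c₀ : G₀)
    (hc : e ((IsCMField.complexConj K).restrictScalars ℚ) = c₀) (T₀ : Finset G₀)
    (hcm : ∀ x : G₀, x ∈ T₀ ↔ c₀ * x ∉ T₀) (hprim : ∀ v : G₀, v ≠ 1 → ∃ w : G₀, ¬ (w ∈ T₀ ↔ v * w ∈ T₀))
    (D : Finset G₀) (hbal : ∀ g : G₀, 2 * (D.filter fun x => x * g ∈ T₀).card = D.card)
    (hmov : ∃ x ∈ D, c₀ * x ∉ D) (φ₀ : K →+* ℂ) :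
    ∃ Φ : CMType K, IsPrimitive (ℂ ≃+* ℂ) Φ.1 φ₀ ∧ ¬ IsNondegenerate Φ := by
  classical
  obtain ⟨Φ, hprimΦ, hread⟩ := GaloisTable.exists_isPrimitive_of_tableModel (K := K) (X := G₀)
    (fun y z => y * z) e.toEquiv (fun _ _ => map_mul e _ _) c₀ hc 1 (map_one e) T₀ hcm hprim φ₀
  -- pull the certificate back to `Gal(K/ℚ)`
  set S : Finset (K ≃ₐ[ℚ] K) := Finset.univ.filter fun g => e g ∈ T₀ with hS_def
  have hS : ∀ g, g ∈ S ↔ embOf φ₀ g ∈ Φ.1 := fun g => by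
    have h := hread (e g)
    have h2 : embOf φ₀ (e.toEquiv.symm (e g)) = embOf φ₀ g := congrArg (embOf φ₀) (e.toEquiv.symm_apply_apply g)
    rw [h2] at h
    rw [hS_def, Finset.mem_filter, ← h]
    simp
  let ι : G₀ ↪ (K ≃ₐ[ℚ] K) := ⟨e.symm, e.symm.injective⟩
  set D' : Finset (K ≃ₐ[ℚ] K) := D.map ι with hD'_def
  have hbal' : ∀ g : K ≃ₐ[ℚ] K, 2 * (D'.filter fun x => x * g ∈ S).card = D'.card := by
    intro g
    rw [hD'_def, Finset.filter_map, Finset.card_map, Finset.card_map, ← hbal (e g)]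
    congr 2
    ext y
    simp only [Finset.mem_filter, Function.comp_apply, and_congr_right_iff]
    intro _
    change e.symm y * g ∈ S ↔ y * e g ∈ T₀
    rw [hS_def, Finset.mem_filter, map_mul, MulEquiv.apply_symm_apply]
    simp
  have hmov' : ∃ x ∈ D', (IsCMField.complexConj K).restrictScalars ℚ * x ∉ D' := by
    obtain ⟨x₀, hx₀, hcx₀⟩ := hmov
    refine ⟨e.symm x₀, Finset.mem_map.2 ⟨x₀, hx₀, rfl⟩, fun h => hcx₀ ?_⟩
    obtain ⟨y, hy, hyx⟩ := Finset.mem_map.1 h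
    have : y = c₀ * x₀ := by
      apply e.symm.injective
      rw [map_mul, ← hc, MulEquiv.symm_apply_apply]
      exact hyx
    rwa [← this]
  exact ⟨Φ, hprimΦ, not_isNondegenerate_of_galois_balanced Φ φ₀ S hS D' hbal' hmov'⟩

/-- **… realised: a SIMPLE DEGENERATE CM abelian variety of dimension `[K:ℚ]/2`** with an exceptional Hodge class on
some power. [cite: Shimura1998, §6.2 Thm. 3 and §8.2 Prop. 26] [cite: Gordon1999HodgeAVSurvey, Thm. 6.4] -/
theorem exists_simple_degenerate_of_model_balanced [IsGalois ℚ K] {G₀ : Type*} [Group G₀] [Fintype G₀]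
    [DecidableEq G₀] (e : (K ≃ₐ[ℚ] K) ≃* G₀) (c₀ : G₀) (hc : e ((IsCMField.complexConj K).restrictScalars ℚ) = c₀)
    (T₀ : Finset G₀) (hcm : ∀ x : G₀, x ∈ T₀ ↔ c₀ * x ∉ T₀)
    (hprim : ∀ v : G₀, v ≠ 1 → ∃ w : G₀, ¬ (w ∈ T₀ ↔ v * w ∈ T₀)) (D : Finset G₀)
    (hbal : ∀ g : G₀, 2 * (D.filter fun x => x * g ∈ T₀).card = D.card) (hmov : ∃ x ∈ D, c₀ * x ∉ D) :
    ∃ (Φ : CMType K) (φ₀ : K →+* ℂ) (A : AbelianVariety ℂ) (ι : 𝓞 K →+* End A)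
      (θ : K →+* Module.End ℂ (complexBetti A.X 1)),
      IsPrimitive (ℂ ≃+* ℂ) Φ.1 φ₀ ∧ ¬ IsNondegenerate Φ ∧ IsCMTypeRealisation Φ A ι θ ∧ A.IsSimple ∧
      A.dim = Fintype.card G₀ / 2 ∧
      ∃ n p : ℕ, ∃ x : complexBetti (⨁ fun _ : Fin n => A).X (2 * p), IsRationalClass x ∧
        IsOfHodgeType (⨁ fun _ : Fin n => A).dim (⨁ fun _ : Fin n => A).X (2 * p) p p x ∧
        x ∉ divisorClassesSpan (⨁ fun _ : Fin n => A).X (⨁ fun _ : Fin n => A).dim p := by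
  obtain ⟨φ₀⟩ := (inferInstance : Nonempty (K →+* ℂ))
  obtain ⟨Φ, hprimΦ, hdeg⟩ :=
    exists_isPrimitive_not_isNondegenerate_of_model_balanced e c₀ hc T₀ hcm hprim D hbal hmov φ₀
  obtain ⟨A, ι, θ, hA, hs, hdim⟩ := exists_simple_realisation_of_isPrimitive Φ φ₀ hprimΦ
  refine ⟨Φ, φ₀, A, ι, θ, hprimΦ, hdeg, hA, hs, ?_, exists_exceptional_pow_of_not_isNondegenerate φ₀ hprimΦ hdeg hA⟩
  rw [hdim, card_model_eq_finrank e]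

/-! ## §2 The five models -/

section Models

variable [IsGalois ℚ K]

/-- `D₁₂`: the only central involution is `r 6`. [folklore] -/
theorem central_involution_dihedral_twelve : ∀ x : DihedralGroup 12, x * x = 1 → x ≠ 1 →
    (∀ y : DihedralGroup 12, x * y = y * x) → x = DihedralGroup.r 6 := by
  decide

open DihedralGroup in
/-- **`Gal(K/ℚ) ≅ D₁₂` (dihedral of order `24`; complex conjugation `= r⁶`): a simple DEGENERATE abelian 12-fold with
CM by `K`** (certificate of rank `11`: `T₀` balanced over the right cosets of `⟨r⁴, s r³⟩ ≅ S₃`).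
[cite: Shimura1998, §6.2 Thm. 3 and §8.2 Prop. 26] [cite: Gordon1999HodgeAVSurvey, Thm. 6.4] -/
theorem exists_simple_degenerate_of_mulEquiv_dihedral_twelve (e : (K ≃ₐ[ℚ] K) ≃* DihedralGroup 12) :
    ∃ (Φ : CMType K) (φ₀ : K →+* ℂ) (A : AbelianVariety ℂ) (ι : 𝓞 K →+* End A)
      (θ : K →+* Module.End ℂ (complexBetti A.X 1)),
      IsPrimitive (ℂ ≃+* ℂ) Φ.1 φ₀ ∧ ¬ IsNondegenerate Φ ∧ IsCMTypeRealisation Φ A ι θ ∧ A.IsSimple ∧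
      A.dim = 12 ∧
      ∃ n p : ℕ, ∃ x : complexBetti (⨁ fun _ : Fin n => A).X (2 * p), IsRationalClass x ∧
        IsOfHodgeType (⨁ fun _ : Fin n => A).dim (⨁ fun _ : Fin n => A).X (2 * p) p p x ∧
        x ∉ divisorClassesSpan (⨁ fun _ : Fin n => A).X (⨁ fun _ : Fin n => A).dim p := by
  have hc : e ((IsCMField.complexConj K).restrictScalars ℚ) = r 6 :=
    central_involution_dihedral_twelve _ (model_complexConj_mul_self e rfl) (model_complexConj_ne_one e rfl)
      (model_complexConj_comm e rfl)
  have h := exists_simple_degenerate_of_model_balanced e (r 6) hc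
    {r 0, r 1, r 2, r 3, r 4, r 5, sr 0, sr 1, sr 2, sr 3, sr 5, sr 10} (by decide) (by decide)
    {r 0, r 4, r 8, sr 3, sr 7, sr 11} (by decide) (by decide)
  rwa [DihedralGroup.card] at h

/-- `Q₈ × C₃`: the only central involution is `(a 2, 1)`. [folklore] -/
theorem central_involution_quaternion_times_three : ∀ x : QuaternionGroup 2 × Multiplicative (ZMod 3),
    x * x = 1 → x ≠ 1 → (∀ y, x * y = y * x) → x = (QuaternionGroup.a 2, Multiplicative.ofAdd 0) := by
  decide

open QuaternionGroup in
/-- **`Gal(K/ℚ) ≅ Q₈ × C₃`: a simple DEGENERATE abelian 12-fold with CM by `K`** (certificate of rank `9`).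
[cite: Shimura1998, §6.2 Thm. 3 and §8.2 Prop. 26] [cite: Gordon1999HodgeAVSurvey, Thm. 6.4] -/
theorem exists_simple_degenerate_of_mulEquiv_quaternion_times_three
    (e : (K ≃ₐ[ℚ] K) ≃* QuaternionGroup 2 × Multiplicative (ZMod 3)) :
    ∃ (Φ : CMType K) (φ₀ : K →+* ℂ) (A : AbelianVariety ℂ) (ι : 𝓞 K →+* End A)
      (θ : K →+* Module.End ℂ (complexBetti A.X 1)),
      IsPrimitive (ℂ ≃+* ℂ) Φ.1 φ₀ ∧ ¬ IsNondegenerate Φ ∧ IsCMTypeRealisation Φ A ι θ ∧ A.IsSimple ∧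
      A.dim = 12 ∧
      ∃ n p : ℕ, ∃ x : complexBetti (⨁ fun _ : Fin n => A).X (2 * p), IsRationalClass x ∧
        IsOfHodgeType (⨁ fun _ : Fin n => A).dim (⨁ fun _ : Fin n => A).X (2 * p) p p x ∧
        x ∉ divisorClassesSpan (⨁ fun _ : Fin n => A).X (⨁ fun _ : Fin n => A).dim p := by
  have hc : e ((IsCMField.complexConj K).restrictScalars ℚ) = (a 2, Multiplicative.ofAdd 0) :=
    central_involution_quaternion_times_three _ (model_complexConj_mul_self e rfl)
      (model_complexConj_ne_one e rfl) (model_complexConj_comm e rfl)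
  have h := exists_simple_degenerate_of_model_balanced e _ hc
    {(a 0, Multiplicative.ofAdd 0), (a 0, Multiplicative.ofAdd 1), (a 0, Multiplicative.ofAdd 2),
      (a 1, Multiplicative.ofAdd 0), (a 1, Multiplicative.ofAdd 1), (a 3, Multiplicative.ofAdd 2),
      (xa 0, Multiplicative.ofAdd 0), (xa 0, Multiplicative.ofAdd 2), (xa 1, Multiplicative.ofAdd 0),
      (xa 2, Multiplicative.ofAdd 1), (xa 3, Multiplicative.ofAdd 1), (xa 3, Multiplicative.ofAdd 2)}
    (by decide) (by decide)
    {(a 0, Multiplicative.ofAdd 0), (a 1, Multiplicative.ofAdd 0), (a 2, Multiplicative.ofAdd 1),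
      (a 3, Multiplicative.ofAdd 2), (xa 0, Multiplicative.ofAdd 1), (xa 2, Multiplicative.ofAdd 2)}
    (by decide) (by decide)
  rwa [Fintype.card_prod, QuaternionGroup.card, Fintype.card_multiplicative, ZMod.card] at h

open QuaternionGroup in
/-- **`Gal(K/ℚ) ≅ Dic₃ × C₂` with complex conjugation `(a³, 1)` (the case WITHOUT imaginary quadratic subfield): a
simple DEGENERATE abelian 12-fold with CM by `K`** (rank `11`). [cite: Shimura1998, §6.2 Thm. 3 and §8.2 Prop. 26]
[cite: Gordon1999HodgeAVSurvey, Thm. 6.4] -/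
theorem exists_simple_degenerate_of_mulEquiv_dicyclicThree_times_two_a
    (e : (K ≃ₐ[ℚ] K) ≃* QuaternionGroup 3 × Multiplicative (ZMod 2))
    (hc : e ((IsCMField.complexConj K).restrictScalars ℚ) = (a 3, Multiplicative.ofAdd 0)) :
    ∃ (Φ : CMType K) (φ₀ : K →+* ℂ) (A : AbelianVariety ℂ) (ι : 𝓞 K →+* End A)
      (θ : K →+* Module.End ℂ (complexBetti A.X 1)),
      IsPrimitive (ℂ ≃+* ℂ) Φ.1 φ₀ ∧ ¬ IsNondegenerate Φ ∧ IsCMTypeRealisation Φ A ι θ ∧ A.IsSimple ∧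
      A.dim = 12 ∧
      ∃ n p : ℕ, ∃ x : complexBetti (⨁ fun _ : Fin n => A).X (2 * p), IsRationalClass x ∧
        IsOfHodgeType (⨁ fun _ : Fin n => A).dim (⨁ fun _ : Fin n => A).X (2 * p) p p x ∧
        x ∉ divisorClassesSpan (⨁ fun _ : Fin n => A).X (⨁ fun _ : Fin n => A).dim p := by
  have h := exists_simple_degenerate_of_model_balanced e _ hc
    {(a 0, Multiplicative.ofAdd 0), (a 0, Multiplicative.ofAdd 1), (a 1, Multiplicative.ofAdd 0),
      (a 1, Multiplicative.ofAdd 1), (a 2, Multiplicative.ofAdd 0), (a 2, Multiplicative.ofAdd 1),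
      (xa 0, Multiplicative.ofAdd 0), (xa 0, Multiplicative.ofAdd 1), (xa 1, Multiplicative.ofAdd 0),
      (xa 2, Multiplicative.ofAdd 0), (xa 4, Multiplicative.ofAdd 1), (xa 5, Multiplicative.ofAdd 1)}
    (by decide) (by decide)
    {(a 0, Multiplicative.ofAdd 0), (a 1, Multiplicative.ofAdd 1), (a 2, Multiplicative.ofAdd 0),
      (a 3, Multiplicative.ofAdd 1), (a 4, Multiplicative.ofAdd 0), (a 5, Multiplicative.ofAdd 1)}
    (by decide) (by decide)
  rwa [Fintype.card_prod, QuaternionGroup.card, Fintype.card_multiplicative, ZMod.card] at h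

open QuaternionGroup in
/-- **`Gal(K/ℚ) ≅ Dic₃ × C₂` with complex conjugation `(1, z)`** (`K` = a totally real dicyclic dodecic field times an
imaginary quadratic one): a simple DEGENERATE abelian 12-fold (rank `11`; cf. gen 19's capstone, `[K:k] = 12`).
[cite: Shimura1998, §6.2 Thm. 3 and §8.2 Prop. 26] [cite: Gordon1999HodgeAVSurvey, Thm. 6.4] -/
theorem exists_simple_degenerate_of_mulEquiv_dicyclicThree_times_two_z
    (e : (K ≃ₐ[ℚ] K) ≃* QuaternionGroup 3 × Multiplicative (ZMod 2))
    (hc : e ((IsCMField.complexConj K).restrictScalars ℚ) = (a 0, Multiplicative.ofAdd 1)) :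
    ∃ (Φ : CMType K) (φ₀ : K →+* ℂ) (A : AbelianVariety ℂ) (ι : 𝓞 K →+* End A)
      (θ : K →+* Module.End ℂ (complexBetti A.X 1)),
      IsPrimitive (ℂ ≃+* ℂ) Φ.1 φ₀ ∧ ¬ IsNondegenerate Φ ∧ IsCMTypeRealisation Φ A ι θ ∧ A.IsSimple ∧
      A.dim = 12 ∧
      ∃ n p : ℕ, ∃ x : complexBetti (⨁ fun _ : Fin n => A).X (2 * p), IsRationalClass x ∧
        IsOfHodgeType (⨁ fun _ : Fin n => A).dim (⨁ fun _ : Fin n => A).X (2 * p) p p x ∧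
        x ∉ divisorClassesSpan (⨁ fun _ : Fin n => A).X (⨁ fun _ : Fin n => A).dim p := by
  have h := exists_simple_degenerate_of_model_balanced e _ hc
    {(a 0, Multiplicative.ofAdd 0), (a 1, Multiplicative.ofAdd 0), (a 2, Multiplicative.ofAdd 0),
      (a 3, Multiplicative.ofAdd 0), (a 4, Multiplicative.ofAdd 0), (a 5, Multiplicative.ofAdd 0),
      (xa 0, Multiplicative.ofAdd 0), (xa 1, Multiplicative.ofAdd 0), (xa 2, Multiplicative.ofAdd 0),
      (xa 3, Multiplicative.ofAdd 0), (xa 4, Multiplicative.ofAdd 1), (xa 5, Multiplicative.ofAdd 1)}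
    (by decide) (by decide)
    {(a 0, Multiplicative.ofAdd 0), (a 1, Multiplicative.ofAdd 1), (a 2, Multiplicative.ofAdd 0),
      (a 3, Multiplicative.ofAdd 1), (a 4, Multiplicative.ofAdd 0), (a 5, Multiplicative.ofAdd 1)}
    (by decide) (by decide)
  rwa [Fintype.card_prod, QuaternionGroup.card, Fintype.card_multiplicative, ZMod.card] at h

open QuaternionGroup in
/-- **`Gal(K/ℚ) ≅ Dic₃ × C₂` with complex conjugation `(a³, z)`**: a simple DEGENERATE abelian 12-fold (rank `11`).
[cite: Shimura1998, §6.2 Thm. 3 and §8.2 Prop. 26] [cite: Gordon1999HodgeAVSurvey, Thm. 6.4] -/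
theorem exists_simple_degenerate_of_mulEquiv_dicyclicThree_times_two_az
    (e : (K ≃ₐ[ℚ] K) ≃* QuaternionGroup 3 × Multiplicative (ZMod 2))
    (hc : e ((IsCMField.complexConj K).restrictScalars ℚ) = (a 3, Multiplicative.ofAdd 1)) :
    ∃ (Φ : CMType K) (φ₀ : K →+* ℂ) (A : AbelianVariety ℂ) (ι : 𝓞 K →+* End A)
      (θ : K →+* Module.End ℂ (complexBetti A.X 1)),
      IsPrimitive (ℂ ≃+* ℂ) Φ.1 φ₀ ∧ ¬ IsNondegenerate Φ ∧ IsCMTypeRealisation Φ A ι θ ∧ A.IsSimple ∧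
      A.dim = 12 ∧
      ∃ n p : ℕ, ∃ x : complexBetti (⨁ fun _ : Fin n => A).X (2 * p), IsRationalClass x ∧
        IsOfHodgeType (⨁ fun _ : Fin n => A).dim (⨁ fun _ : Fin n => A).X (2 * p) p p x ∧
        x ∉ divisorClassesSpan (⨁ fun _ : Fin n => A).X (⨁ fun _ : Fin n => A).dim p := by
  have h := exists_simple_degenerate_of_model_balanced e _ hc
    {(a 0, Multiplicative.ofAdd 0), (a 0, Multiplicative.ofAdd 1), (a 1, Multiplicative.ofAdd 0),
      (a 1, Multiplicative.ofAdd 1), (a 2, Multiplicative.ofAdd 0), (a 2, Multiplicative.ofAdd 1),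
      (xa 0, Multiplicative.ofAdd 0), (xa 0, Multiplicative.ofAdd 1), (xa 1, Multiplicative.ofAdd 0),
      (xa 2, Multiplicative.ofAdd 1), (xa 4, Multiplicative.ofAdd 0), (xa 5, Multiplicative.ofAdd 1)}
    (by decide) (by decide)
    {(a 0, Multiplicative.ofAdd 0), (a 1, Multiplicative.ofAdd 0), (a 2, Multiplicative.ofAdd 0),
      (a 3, Multiplicative.ofAdd 0), (a 4, Multiplicative.ofAdd 0), (a 5, Multiplicative.ofAdd 0)}
    (by decide) (by decide)
  rwa [Fintype.card_prod, QuaternionGroup.card, Fintype.card_multiplicative, ZMod.card] at h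

/-- `C₃ × D₄`: the only central involution is `(1, r 2)`. [folklore] -/
theorem central_involution_three_times_dihedral_four : ∀ x : Multiplicative (ZMod 3) × DihedralGroup 4,
    x * x = 1 → x ≠ 1 → (∀ y, x * y = y * x) → x = (Multiplicative.ofAdd 0, DihedralGroup.r 2) := by
  decide

open DihedralGroup in
/-- **`Gal(K/ℚ) ≅ C₃ × D₄` (complex conjugation `= (1, r²)`): a simple DEGENERATE abelian 12-fold with CM by `K`**
(certificate of rank `7`). [cite: Shimura1998, §6.2 Thm. 3 and §8.2 Prop. 26] [cite: Gordon1999HodgeAVSurvey, Thm. 6.4] -/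
theorem exists_simple_degenerate_of_mulEquiv_three_times_dihedral_four
    (e : (K ≃ₐ[ℚ] K) ≃* Multiplicative (ZMod 3) × DihedralGroup 4) :
    ∃ (Φ : CMType K) (φ₀ : K →+* ℂ) (A : AbelianVariety ℂ) (ι : 𝓞 K →+* End A)
      (θ : K →+* Module.End ℂ (complexBetti A.X 1)),
      IsPrimitive (ℂ ≃+* ℂ) Φ.1 φ₀ ∧ ¬ IsNondegenerate Φ ∧ IsCMTypeRealisation Φ A ι θ ∧ A.IsSimple ∧
      A.dim = 12 ∧
      ∃ n p : ℕ, ∃ x : complexBetti (⨁ fun _ : Fin n => A).X (2 * p), IsRationalClass x ∧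
        IsOfHodgeType (⨁ fun _ : Fin n => A).dim (⨁ fun _ : Fin n => A).X (2 * p) p p x ∧
        x ∉ divisorClassesSpan (⨁ fun _ : Fin n => A).X (⨁ fun _ : Fin n => A).dim p := by
  have hc : e ((IsCMField.complexConj K).restrictScalars ℚ) = (Multiplicative.ofAdd 0, r 2) :=
    central_involution_three_times_dihedral_four _ (model_complexConj_mul_self e rfl)
      (model_complexConj_ne_one e rfl) (model_complexConj_comm e rfl)
  have h := exists_simple_degenerate_of_model_balanced e _ hc
    {(Multiplicative.ofAdd 0, r 0), (Multiplicative.ofAdd 0, r 1), (Multiplicative.ofAdd 0, sr 0),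
      (Multiplicative.ofAdd 0, sr 1), (Multiplicative.ofAdd 1, r 0), (Multiplicative.ofAdd 1, r 1),
      (Multiplicative.ofAdd 1, sr 0), (Multiplicative.ofAdd 1, sr 1), (Multiplicative.ofAdd 2, r 0),
      (Multiplicative.ofAdd 2, r 3), (Multiplicative.ofAdd 2, sr 1), (Multiplicative.ofAdd 2, sr 2)}
    (by decide) (by decide)
    {(Multiplicative.ofAdd 0, r 0), (Multiplicative.ofAdd 0, sr 1), (Multiplicative.ofAdd 1, r 2),
      (Multiplicative.ofAdd 1, sr 3)}
    (by decide) (by decide)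
  rwa [Fintype.card_prod, DihedralGroup.card, Fintype.card_multiplicative, ZMod.card] at h

/-- `C₄ × S₃` (`S₃ = D₃`): the only central involution is `(2, 1)`. [folklore] -/
theorem central_involution_four_times_dihedral_three : ∀ x : Multiplicative (ZMod 4) × DihedralGroup 3,
    x * x = 1 → x ≠ 1 → (∀ y, x * y = y * x) → x = (Multiplicative.ofAdd 2, DihedralGroup.r 0) := by
  decide

open DihedralGroup in
/-- **`Gal(K/ℚ) ≅ C₄ × S₃` (complex conjugation `= (2, 1)`): a simple DEGENERATE abelian 12-fold with CM by `K`**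
(certificate of rank `9`). [cite: Shimura1998, §6.2 Thm. 3 and §8.2 Prop. 26] [cite: Gordon1999HodgeAVSurvey, Thm. 6.4] -/
theorem exists_simple_degenerate_of_mulEquiv_four_times_dihedral_three
    (e : (K ≃ₐ[ℚ] K) ≃* Multiplicative (ZMod 4) × DihedralGroup 3) :
    ∃ (Φ : CMType K) (φ₀ : K →+* ℂ) (A : AbelianVariety ℂ) (ι : 𝓞 K →+* End A)
      (θ : K →+* Module.End ℂ (complexBetti A.X 1)),
      IsPrimitive (ℂ ≃+* ℂ) Φ.1 φ₀ ∧ ¬ IsNondegenerate Φ ∧ IsCMTypeRealisation Φ A ι θ ∧ A.IsSimple ∧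
      A.dim = 12 ∧
      ∃ n p : ℕ, ∃ x : complexBetti (⨁ fun _ : Fin n => A).X (2 * p), IsRationalClass x ∧
        IsOfHodgeType (⨁ fun _ : Fin n => A).dim (⨁ fun _ : Fin n => A).X (2 * p) p p x ∧
        x ∉ divisorClassesSpan (⨁ fun _ : Fin n => A).X (⨁ fun _ : Fin n => A).dim p := by
  have hc : e ((IsCMField.complexConj K).restrictScalars ℚ) = (Multiplicative.ofAdd 2, r 0) :=
    central_involution_four_times_dihedral_three _ (model_complexConj_mul_self e rfl)
      (model_complexConj_ne_one e rfl) (model_complexConj_comm e rfl)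
  have h := exists_simple_degenerate_of_model_balanced e _ hc
    {(Multiplicative.ofAdd 0, r 0), (Multiplicative.ofAdd 0, r 1), (Multiplicative.ofAdd 0, r 2),
      (Multiplicative.ofAdd 0, sr 0), (Multiplicative.ofAdd 0, sr 1), (Multiplicative.ofAdd 0, sr 2),
      (Multiplicative.ofAdd 1, r 0), (Multiplicative.ofAdd 1, r 1), (Multiplicative.ofAdd 1, sr 0),
      (Multiplicative.ofAdd 3, r 2), (Multiplicative.ofAdd 3, sr 1), (Multiplicative.ofAdd 3, sr 2)}
    (by decide) (by decide)
    {(Multiplicative.ofAdd 0, r 0), (Multiplicative.ofAdd 0, sr 1), (Multiplicative.ofAdd 2, r 1),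
      (Multiplicative.ofAdd 2, sr 2)}
    (by decide) (by decide)
  rwa [Fintype.card_prod, DihedralGroup.card, Fintype.card_multiplicative, ZMod.card] at h

end Models

end Summit.HodgeConjecture.CorCM.GaloisModels

end
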